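import Literature.Geometry.Lorentzian.CauchyHypersurfaceShadowNeighbourhood
import Literature.Geometry.Lorentzian.SubdevelopmentUnionCauchy
import Literature.Geometry.Lorentzian.LocalCauchyLens
import Literature.Geometry.Lorentzian.CauchyHypersurfaceOpensIntersection
import Literature.Geometry.Lorentzian.CausalityAchronalProofs
import Literature.Geometry.Lorentzian.KillingUniqueContinuation
import Literature.Geometry.Lorentzian.KillingCoherentContinuation
import HarnessLib

/-!
# Globalisation of Killing fields from a neighbourhood of a Cauchy hypersurface, modulo the
# local continuation step (Moncrief 1975, §III; Fischer–Marsden–Moncrief 1980, Lemma 2.2)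

Let `S` be a Cauchy hypersurface of the connected time-oriented `C^∞` Lorentzian manifold
`(M, g, τ)` and `ξ` a Killing field of `g` on an open neighbourhood `U₀` of `S`. Moncrief's
theorem (J. Math. Phys. 16 (1975) 493, §III; Fischer–Marsden–Moncrief, Ann. IHP A 33 (1980) 147,
Lemma 2.2) develops the Killing initial data of `ξ` on `S` to a Killing field of the whole Cauchy
development `M`, by solving the hyperbolic system `□ξ' + Ric·ξ' = 0`. The present file proves the
**globalisation half** of this theorem, in the topological form it takes once the PDE is
localised: *assuming the local continuation step* — a Killing field given on the strict past
`{f < 0}` of a local temporal function `f` near a point `p₀` with `f p₀ = 0` extends to a Killing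
field of a full neighbourhood of `p₀` (hypothesis `hstep`, proved separately from the vacuum
field equations by the linear wave equation for `ξ'` and for its deformation tensor) — a Killing
field on a neighbourhood of `S` agrees near `S` with a Killing field of all of `M`
(`IsCauchyHypersurface.exists_isKillingFieldOn_univ_of_localStep`).

The continuation is organised exactly as Sbierski's dezornified existence proof of the maximal
Cauchy development (Ann. Henri Poincaré 17 (2016) 301, §3.2, proof of Thm. 12), with Killing
fields in place of isometric embeddings:

* admissible regions are the open `V ⊇ V₀` (a fixed causally convex neighbourhood of `S` inside
  `U₀`, `CauchyHypersurfaceShadowNeighbourhood`) which are causally convex relative to `S`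
  (`J⁻(x) ∩ J⁺(S) ⊆ V`, `J⁺(x) ∩ J⁻(S) ⊆ V`) and carry a Killing field equal to `ξ` on `V₀`;
  any two admissible Killing fields agree on the intersection of their domains
  (`isKillingFieldOn_apply_eq_of_causallyConvex`: a point of `V ∩ V'` is joined to `S ⊆ V₀`
  inside `V ∩ V'` by a causal curve, and Killing fields of a `C^∞` metric have the unique
  continuation property, `KillingUniqueContinuation`), so the union `Good` of all admissible
  regions is admissible (`IsKillingFieldOn.of_locally`);
* if `Good ≠ M`, its frontier meets `I⁺(S)` or `I⁻(S)` (`SubdevelopmentBoundaryPoint`), and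
  Sbierski's Lemmas 15–16 give a frontier point `p₀` and a local temporal function `f`,
  `f p₀ = 0`, with `{f < 0} ⊆ Good` and `{f = 0} ⊆ closure Good` near `p₀`
  (`exists_temporal_boundaryPoint_future'`); the local step extends the Killing field across
  `p₀` to some `N ∋ p₀`; a lens `V_L ∋ p₀` inside `N ∩ I⁺(S)` in which `{f = 0}` is a Cauchy
  hypersurface (`LocalCauchyLens`) makes `S` a Cauchy hypersurface of `Good ∪ V_L`
  (`SubdevelopmentUnionCauchy`), hence `Good ∪ V_L` causally convex
  (`IsCauchyHypersurface.causalPast_inter_causalFuture_subset_of_restrict`), and the two Killing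
  fields agree on `Good ∩ V_L` (`isKillingFieldOn_apply_eq_of_lens`: every point of `Good ∩ V_L`
  is joined inside `Good ∩ V_L` to `{f < 0}`, along the orienting timelike curve, `f` being
  strictly increasing along it); so `Good ∪ V_L ∋ p₀` is admissible — a contradiction.

All results are proved; no definitions, no named facts (D-0026). The local step is the explicit
hypothesis `hstep` of the last two theorems, quantified over all time orientations of `g` (it is
used for `τ` at future frontier points and for `-τ` at past ones).

## References

* V. Moncrief, *Spacetime symmetries and linearization stability of the Einstein equations. I*,
  J. Math. Phys. 16 (1975) 493–498, §III.
* A. E. Fischer, J. E. Marsden, V. Moncrief, *The structure of the space of solutions of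
  Einstein's equations. I. One Killing field*, Ann. Inst. H. Poincaré A 33 (1980) 147–194,
  Lemma 2.2 (pp. 161–162).
* J. Sbierski, *On the existence of a maximal Cauchy development for the Einstein equations: a
  dezornification*, Ann. Henri Poincaré 17 (2016) 301–329 = arXiv:1309.7591, §3.2, Lemmas 15–16
  and proof of Thm. 12.
* B. O'Neill, *Semi-Riemannian geometry*, Academic Press 1983, Ch. 9, Lemma 9.28 (continuation
  of Killing fields); Ch. 14, Cor. 14.1, Lemma 14.29, Thm. 14.38.
-/

noncomputable section

open Bundle Set Filter Function Topology TopologicalSpace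
open scoped Manifold ContDiff Topology

namespace Literature.Geometry.Lorentzian

namespace LorentzianMetric

/-! ### Causal preliminaries (general model) -/

section Causal

variable {E : Type*} [NormedAddCommGroup E] [NormedSpace ℝ E] {H : Type*} [TopologicalSpace H]
  {I : ModelWithCorners ℝ E H} {n : ℕ∞ω} {M : Type*} [TopologicalSpace M] [ChartedSpace H M]
  [IsManifold I ∞ M] {g : LorentzianMetric I n M} (τ : TimeOrientation g)

/-- **A temporal function increases strictly along future causal curves.** If `f` is
differentiable on `O` with `df_x(v) > 0` for every `x ∈ O` and every future-directed causal
`v ∈ TₓM`, then `f ∘ γ` is strictly increasing along every future causal curve `γ` running in `O`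
on an interval `J` (chain rule and the mean value theorem). Hawking–Ellis 1973, §6.4, p. 198
(time functions increase along every future-directed causal curve).
[cite: HawkingEllis1973CUP, §6.4, p. 198] -/
theorem strictMonoOn_comp_of_mfderiv_pos {O : Set M} {f : M → ℝ}
    (hf : ∀ x ∈ O, MDifferentiableAt I 𝓘(ℝ, ℝ) f x)
    (hdf : ∀ x ∈ O, ∀ v : TangentSpace I x, τ.IsFutureDirected v →
      (0 : ℝ) < mfderiv I 𝓘(ℝ, ℝ) f x v)
    {γ : ℝ → M} {J : Set ℝ} (hJ : J.OrdConnected) (hγ : g.IsFutureCausalCurveOn τ γ J)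
    (hγO : ∀ t ∈ J, γ t ∈ O) : StrictMonoOn (f ∘ γ) J := by
  have hd : ∀ t ∈ J, HasDerivAt (f ∘ γ) (mfderiv I 𝓘(ℝ, ℝ) f (γ t) (velocity I γ t)) t :=
    fun t ht ↦ hasDerivAt_comp_curve (hf _ (hγO t ht)) (hγ t ht).1
  refine strictMonoOn_of_deriv_pos hJ.convex
    (fun t ht ↦ (hd t ht).continuousAt.continuousWithinAt) fun t ht ↦ ?_
  have ht' : t ∈ J := interior_subset ht
  rw [(hd t ht').deriv]
  exact hdf _ (hγO t ht') _ (hγ t ht').2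

/-- **Every neighbourhood of `x` contains points of `I⁺(x)`**: the maximal integral curve of the
orienting timelike field through `x` is a future timelike curve through `x`
(`exists_isEndlessTimelikeCurve_isMIntegralCurveAt`), and its points at small positive parameters
lie in the neighbourhood. O'Neill 1983, Ch. 14, p. 402 (the relation `≪`) with Prop. 14.31
(proof, p. 417). [cite: ONeillSemiRiemannian1983, Ch. 14, p. 402 and Prop. 31 (proof, p. 417)] -/
theorem exists_mem_chronologicalFuture_singleton_of_mem_nhds [T2Space M]
    [BoundarylessManifold I M] [CompleteSpace E] (hn : 1 ≤ n) (x : M) {W : Set M}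
    (hW : W ∈ 𝓝 x) : ∃ x' ∈ W, x' ∈ g.chronologicalFuture τ {x} := by
  have hT1 : ContMDiff I I.tangent 1 (fun y ↦ (⟨y, τ.vectorField y⟩ : TangentBundle I M)) :=
    τ.contMDiff.of_le hn
  obtain ⟨Γ, D, hΓ, hDo, h0D, hΓ0, -⟩ :=
    g.exists_isEndlessTimelikeCurve_isMIntegralCurveAt τ hT1 τ.isTimelike
      τ.isFutureDirected_vectorField x
  obtain ⟨hDord, hΓt, -, -⟩ := hΓ
  have hcont : ContinuousAt Γ 0 := (hΓt 0 h0D).1.continuousAt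
  have hW' : W ∈ 𝓝 (Γ 0) := by rw [hΓ0]; exact hW
  have hev : ∀ᶠ s in 𝓝 (0 : ℝ), Γ s ∈ W ∧ s ∈ D := by
    filter_upwards [hcont.preimage_mem_nhds hW', hDo.mem_nhds h0D] with s hs hs' using ⟨hs, hs'⟩
  obtain ⟨s, ⟨hsW, hsD⟩, hs0⟩ := ((hev.filter_mono nhdsWithin_le_nhds).and
    (self_mem_nhdsWithin : Ioi (0 : ℝ) ∈ 𝓝[>] (0 : ℝ))).exists
  exact ⟨Γ s, hsW, x, rfl, Γ, 0, s, hs0, hΓt.mono (hDord.out h0D hsD), hΓ0, rfl⟩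

/-- **An open sub-spacetime sharing the Cauchy hypersurface is causally convex.** Let `S` be a
Cauchy hypersurface of `(M, g, τ)` (`Cⁿ`, `n ≥ 2`) and `W ⊆ M` open with `S ∩ W` a Cauchy
hypersurface of `(W, g|_W, τ|_W)`. Then `J⁻(x) ∩ J⁺(S) ⊆ W` for every `x ∈ W`. Indeed, if
`S ≤ y ≤ x` with `y ∉ W`, pick `x' ∈ W` with `x ≪ x'`; then `y ≪ x'` (push-up), and the endless
timelike curve through `y` and `x'` extending a timelike segment from `y` to `x'`
(`exists_isEndlessTimelikeCurve_extends`) has its piece in `W` through `x'` crossing `S`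
(`IsCauchyHypersurface.exists_mem_connectedComponentIn`) at a parameter beyond that of `y ∉ W`;
so `y ≪ s` for some `s ∈ S`, i.e. `y ∈ I⁻(S) ∩ J⁺(S) = ∅`. This is the causal convexity of
globally hyperbolic open subsets containing a Cauchy hypersurface, O'Neill 1983, Ch. 14,
Lemma 14.29 and Thm. 14.38 (the Cauchy development `D(S)` contains `J⁻(x) ∩ J⁺(S)` for
`x ∈ D(S)`). [cite: ONeillSemiRiemannian1983, Ch. 14, Lemma 14.29 and Thm. 14.38 (pp. 415–421)] -/
theorem IsCauchyHypersurface.causalPast_inter_causalFuture_subset_of_restrict [T2Space M]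
    [SecondCountableTopology M] [BoundarylessManifold I M] [FiniteDimensional ℝ E]
    [CompleteSpace E] (hn : 2 ≤ n)
    (hres : PseudoRiemannianMetric.contMDiff_restrict (I := I) (n := n) (M := M))
    (hτ : τ.contMDiff_restrict) {S : Set M} (hS : g.IsCauchyHypersurface τ S) {W : Opens M}
    (hW : (g.restrict hres W).IsCauchyHypersurface (τ.restrict hres hτ W) (Subtype.val ⁻¹' S))
    {x : M} (hx : x ∈ W) : g.causalPast τ {x} ∩ g.causalFuture τ S ⊆ W := by
  have hn1 : (1 : ℕ∞ω) ≤ n := le_trans one_le_two hn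
  rintro y ⟨hyx, hyS⟩
  by_contra hyW
  -- a point `x' ≫ x` inside `W`, so that `y ≪ x'`
  obtain ⟨x', hx'W, hxx'⟩ :=
    exists_mem_chronologicalFuture_singleton_of_mem_nhds τ hn1 x (W.isOpen.mem_nhds hx)
  have hyx' : x' ∈ g.chronologicalFuture τ {y} :=
    mem_chronologicalFuture_of_mem_causalFuture hn1 (mem_causalPast_singleton_iff.1 hyx) hxx'
  obtain ⟨y', hy', β, a, b, hab, hβ, hβa, hβb⟩ := hyx'
  have hβay : β a = y := hβa.trans (mem_singleton_iff.1 hy')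
  -- an endless timelike curve through `y` and `x'`
  obtain ⟨Δ, D, hΔ, haD, hbD, hΔa, hΔb⟩ :=
    exists_isEndlessTimelikeCurve_extends (g := g) (τ := τ) hn hab hβ
  have hΔbW : Δ b ∈ W := by rw [hΔb, hβb]; exact hx'W
  -- its piece in `W` through `x'` crosses `S`, at a parameter `t₁ > a`
  obtain ⟨t₁, ht₁J, ht₁S⟩ :=
    IsCauchyHypersurface.exists_mem_connectedComponentIn hres hτ hW hΔ hbD hΔbW
  have hJsub : connectedComponentIn (D ∩ Δ ⁻¹' (W : Set M)) b ⊆ D ∩ Δ ⁻¹' (W : Set M) :=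
    connectedComponentIn_subset _ _
  have hJord : (connectedComponentIn (D ∩ Δ ⁻¹' (W : Set M)) b).OrdConnected :=
    isPreconnected_iff_ordConnected.1 isPreconnected_connectedComponentIn
  have hbJ : b ∈ connectedComponentIn (D ∩ Δ ⁻¹' (W : Set M)) b :=
    mem_connectedComponentIn ⟨hbD, hΔbW⟩
  have hat₁ : a < t₁ := by
    by_contra h
    push Not at h
    have haJ : a ∈ connectedComponentIn (D ∩ Δ ⁻¹' (W : Set M)) b :=
      hJord.out ht₁J hbJ ⟨h, hab.le⟩
    have haW : Δ a ∈ (W : Set M) := (hJsub haJ).2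
    rw [hΔa, hβay] at haW
    exact hyW haW
  -- so `y ≪ Δ t₁ ∈ S`, against `J⁺(S) ∩ I⁻(S) = ∅`
  have ht₁D : t₁ ∈ D := (hJsub ht₁J).1
  have hyI : Δ t₁ ∈ g.chronologicalFuture τ {y} :=
    ⟨y, rfl, Δ, a, t₁, hat₁, hΔ.2.1.mono (hΔ.1.out haD ht₁D), hΔa.trans hβay, rfl⟩
  have hyP : y ∈ g.chronologicalPast τ S :=
    chronologicalFuture_mono (singleton_subset_iff.2 ht₁S)
      (mem_chronologicalPast_of_mem_chronologicalFuture hyI)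
  exact Set.disjoint_left.1 (hS.disjoint_causalFuture_chronologicalPast hn) hyS hyP

/-- **Time dual**: under the same hypotheses `J⁺(x) ∩ J⁻(S) ⊆ W` for every `x ∈ W` (the previous
theorem for `-τ`). [cite: ONeillSemiRiemannian1983, Ch. 14, Lemma 14.29 and Thm. 14.38 (pp. 415–421)] -/
theorem IsCauchyHypersurface.causalFuture_inter_causalPast_subset_of_restrict [T2Space M]
    [SecondCountableTopology M] [BoundarylessManifold I M] [FiniteDimensional ℝ E]
    [CompleteSpace E] (hn : 2 ≤ n)
    (hres : PseudoRiemannianMetric.contMDiff_restrict (I := I) (n := n) (M := M))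
    (hτ : τ.contMDiff_restrict) {S : Set M} (hS : g.IsCauchyHypersurface τ S) {W : Opens M}
    (hW : (g.restrict hres W).IsCauchyHypersurface (τ.restrict hres hτ W) (Subtype.val ⁻¹' S))
    {x : M} (hx : x ∈ W) : g.causalFuture τ {x} ∩ g.causalPast τ S ⊆ W := by
  have hW' : (g.restrict hres W).IsCauchyHypersurface
      (τ.reverse.restrict hres (τ.contMDiff_restrict_reverse hτ) W) (Subtype.val ⁻¹' S) := by
    rw [← TimeOrientation.restrict_reverse]
    exact hW.reverse
  have h := hS.reverse.causalPast_inter_causalFuture_subset_of_restrict τ.reverse hn hres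
    (τ.contMDiff_restrict_reverse hτ) hW' hx
  rwa [causalPast_reverse] at h

end Causal

/-! ### Agreement of Killing fields (`C^∞` metric, boundaryless model) -/

section Killing

variable {E : Type*} [NormedAddCommGroup E] [NormedSpace ℝ E] [FiniteDimensional ℝ E]
  [CompleteSpace E] {M : Type*} [TopologicalSpace M] [ChartedSpace E M]
  [IsManifold 𝓘(ℝ, E) ∞ M] {g : LorentzianMetric 𝓘(ℝ, E) ∞ M} [g.HasLeviCivita]
  (τ : TimeOrientation g)

/-- **Two Killing fields on a causally convex open set which agree near `S` agree on its causal
future part.** Let `A ⊆ M` be open with `J⁻(x) ∩ J⁺(S) ⊆ A` for all `x ∈ A`, `V₀ ⊆ A` an open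
set containing `S`, and `ζ, ζ'` Killing fields of the `C^∞` metric `g` on `A` with `ζ = ζ'` on
`V₀`. Then `ζ x = ζ' x` for every `x ∈ A ∩ J⁺(S)`: a causal curve from `S` to `x` runs in
`J⁻(x) ∩ J⁺(S) ⊆ A`, so the connected component of `x` in `A` meets `V₀`, and Killing fields of
a `C^∞` metric agreeing on a non-empty open subset of a connected open set agree on it
(`IsKillingFieldOn.eqOn_of_isPreconnected_of_eqOn`; O'Neill 1983, Ch. 9, Lemma 9.28 for the
statement, there under analyticity-free form via the Killing transport equations).
[cite: ONeillSemiRiemannian1983, Ch. 9, Lemma 28 (p. 252)] -/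
theorem isKillingFieldOn_apply_eq_of_mem_causalFuture [LocallyConnectedSpace M]
    {S V₀ A : Set M} (hV₀ : IsOpen V₀) (hSV₀ : S ⊆ V₀) (hA : IsOpen A)
    (hconv : ∀ x ∈ A, g.causalPast τ {x} ∩ g.causalFuture τ S ⊆ A)
    {ζ ζ' : Π x : M, TangentSpace 𝓘(ℝ, E) x} (hζ : g.IsKillingFieldOn ζ A)
    (hζ' : g.IsKillingFieldOn ζ' A) (hagree : ∀ y ∈ V₀, ζ y = ζ' y) {x : M} (hx : x ∈ A)
    (hxJ : x ∈ g.causalFuture τ S) : ζ x = ζ' x := by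
  classical
  set C : Set M := connectedComponentIn A x with hC
  have hCo : IsOpen C := hA.connectedComponentIn
  have hCA : C ⊆ A := connectedComponentIn_subset _ _
  have hxC : x ∈ C := mem_connectedComponentIn hx
  -- a point of `C ∩ V₀`
  obtain ⟨z, hzC, hzV₀⟩ : (C ∩ V₀).Nonempty := by
    rcases hxJ with hxS | ⟨z, hzS, γ, a, b, hab, hγ, hγa, hγb⟩
    · exact ⟨x, hxC, hSV₀ hxS⟩
    · -- the causal curve from `z ∈ S` to `x` runs inside `J⁻(x) ∩ J⁺(S) ⊆ A`
      have hK : γ '' Icc a b ⊆ A := by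
        rintro _ ⟨t, ⟨hat, htb⟩, rfl⟩
        refine hconv x hx ⟨mem_causalPast_singleton_iff.2 ?_, ?_⟩
        · rcases htb.eq_or_lt with h | h
          · rw [h, hγb]; exact subset_causalFuture (g := g) (τ := τ) _ rfl
          · exact Or.inr ⟨γ t, rfl, γ, t, b, h, hγ.mono (Icc_subset_Icc_left hat), rfl, hγb⟩
        · rcases hat.eq_or_lt with h | h
          · rw [← h, hγa]; exact subset_causalFuture (g := g) (τ := τ) _ hzS
          · exact Or.inr ⟨z, hzS, γ, a, t, h, hγ.mono (Icc_subset_Icc_right htb), hγa, rfl⟩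
      have hKc : IsPreconnected (γ '' Icc a b) :=
        isPreconnected_Icc.image γ fun t ht ↦ (hγ t ht).1.continuousAt.continuousWithinAt
      have hxK : x ∈ γ '' Icc a b := ⟨b, right_mem_Icc.2 hab.le, hγb⟩
      have hKC : γ '' Icc a b ⊆ C := hKc.subset_connectedComponentIn hxK hK
      exact ⟨z, hKC ⟨a, left_mem_Icc.2 hab.le, hγa⟩, hSV₀ hzS⟩
  have key := PseudoRiemannianMetric.IsKillingFieldOn.eqOn_of_isPreconnected_of_eqOn hCo
    isPreconnected_connectedComponentIn (hCo.inter hV₀) inter_subset_left ⟨z, hzC, hzV₀⟩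
    (hζ.mono hCA) (hζ'.mono hCA) (fun y hy ↦ hagree y hy.2)
  exact key hxC

/-- **Two Killing fields on a causally convex open neighbourhood of a Cauchy hypersurface which
agree near `S` agree everywhere on it.** With `A` causally convex relative to `S` in both time
directions (`J⁻(x) ∩ J⁺(S) ⊆ A` and `J⁺(x) ∩ J⁻(S) ⊆ A` for `x ∈ A`) and `M = J⁺(S) ∪ J⁻(S)`
(O'Neill 1983, Lemma 14.29), the previous theorem and its time dual give `ζ = ζ'` on `A`. This is
the coherence of partial Killing developments in Moncrief's continuation (1975, §III: the
development is unique given the Killing data). [cite: Moncrief1975, §III]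
[cite: ONeillSemiRiemannian1983, Ch. 9, Lemma 28 (p. 252) and Ch. 14, Lemma 29 (p. 415)] -/
theorem isKillingFieldOn_apply_eq_of_causallyConvex [LocallyConnectedSpace M] [T2Space M]
    [SecondCountableTopology M] (hn : (2 : ℕ∞ω) ≤ ∞) {S : Set M}
    (hS : g.IsCauchyHypersurface τ S) {V₀ A : Set M} (hV₀ : IsOpen V₀) (hSV₀ : S ⊆ V₀)
    (hA : IsOpen A)
    (hconv : ∀ x ∈ A, g.causalPast τ {x} ∩ g.causalFuture τ S ⊆ A)
    (hconv' : ∀ x ∈ A, g.causalFuture τ {x} ∩ g.causalPast τ S ⊆ A)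
    {ζ ζ' : Π x : M, TangentSpace 𝓘(ℝ, E) x} (hζ : g.IsKillingFieldOn ζ A)
    (hζ' : g.IsKillingFieldOn ζ' A) (hagree : ∀ y ∈ V₀, ζ y = ζ' y) {x : M} (hx : x ∈ A) :
    ζ x = ζ' x := by
  rcases hS.mem_causalFuture_or_mem_causalPast hn x with h | h
  · exact isKillingFieldOn_apply_eq_of_mem_causalFuture τ hV₀ hSV₀ hA hconv hζ hζ' hagree hx h
  · refine isKillingFieldOn_apply_eq_of_mem_causalFuture τ.reverse hV₀ hSV₀ hA
      (fun y hy ↦ ?_) hζ hζ' hagree hx h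
    rw [causalPast_reverse]
    exact hconv' y hy

/-- **Agreement in a lens across the frontier.** Let `G` be open and causally convex relative to
`S` (`J⁻(x) ∩ J⁺(S) ⊆ G`), `ζ` a Killing field on `G`; `f` a temporal function on `O ⊇ N`
(`df_x(v) > 0` for future-directed `v`), `ζ'` a Killing field on `N` equal to `ζ` on
`{f < 0} ∩ N`; and `V_L ⊆ N ∩ J⁺(S)` open, in which `{f = 0}` is a Cauchy hypersurface. Then
`ζ = ζ'` on `G ∩ V_L`: through `x ∈ G ∩ V_L` the orienting timelike curve, along which `f`
increases strictly, either has `f x < 0` already or runs, inside `V_L`, back from `x` to a point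
`z` of `{f = 0}` and slightly beyond into `{f < 0}`, staying in `J⁻(x) ∩ J⁺(S) ⊆ G`; so the
component of `x` in `G ∩ V_L` meets the open set `{f < 0}` where the fields agree, and unique
continuation applies. This is the agreement "on `U ∩ V`" in Sbierski 2016, §3.2, end of the proof
of Thm. 12, transcribed for Killing fields.
[cite: Sbierski2016AHP, §3.2, proof of Thm. 12 (arXiv numbering)] -/
theorem isKillingFieldOn_apply_eq_of_lens [LocallyConnectedSpace M] [T2Space M]
    (hres : PseudoRiemannianMetric.contMDiff_restrict (I := 𝓘(ℝ, E)) (n := ∞) (M := M))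
    (hτ : τ.contMDiff_restrict) {S G : Set M} (hG : IsOpen G)
    (hconv : ∀ x ∈ G, g.causalPast τ {x} ∩ g.causalFuture τ S ⊆ G)
    {ζ : Π x : M, TangentSpace 𝓘(ℝ, E) x} (hζ : g.IsKillingFieldOn ζ G)
    {O : Set M} {f : M → ℝ} (hfO : ∀ x ∈ O, MDifferentiableAt 𝓘(ℝ, E) 𝓘(ℝ, ℝ) f x)
    (hdf : ∀ x ∈ O, ∀ v : TangentSpace 𝓘(ℝ, E) x, τ.IsFutureDirected v →
      (0 : ℝ) < mfderiv 𝓘(ℝ, E) 𝓘(ℝ, ℝ) f x v)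
    {N : Set M} (hNO : N ⊆ O) {ζ' : Π x : M, TangentSpace 𝓘(ℝ, E) x}
    (hζ' : g.IsKillingFieldOn ζ' N) (hagree : ∀ r ∈ N, f r < 0 → ζ' r = ζ r)
    {VL : Opens M} (hVLN : (VL : Set M) ⊆ N) (hVLS : (VL : Set M) ⊆ g.causalFuture τ S)
    (hVL : (g.restrict hres VL).IsCauchyHypersurface (τ.restrict hres hτ VL)
      (Subtype.val ⁻¹' {q | q ∈ O ∧ f q = 0}))
    {x : M} (hxG : x ∈ G) (hxVL : x ∈ VL) : ζ x = ζ' x := by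
  classical
  have hn1 : (1 : ℕ∞ω) ≤ ∞ := WithTop.coe_le_coe.mpr le_top
  set A : Set M := G ∩ VL with hA_def
  have hA : IsOpen A := hG.inter VL.isOpen
  set C : Set M := connectedComponentIn A x with hC
  have hCo : IsOpen C := hA.connectedComponentIn
  have hCA : C ⊆ A := connectedComponentIn_subset _ _
  have hxC : x ∈ C := mem_connectedComponentIn ⟨hxG, hxVL⟩
  have hCO : C ⊆ O := fun r hr ↦ hNO (hVLN (hCA hr).2)
  -- the open set `C ∩ {f < 0}` on which the fields agree
  have hfC : ContinuousOn f C := fun r hr ↦ (hfO r (hCO hr)).continuousAt.continuousWithinAt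
  have hWo : IsOpen (C ∩ f ⁻¹' Iio 0) := hfC.isOpen_inter_preimage hCo isOpen_Iio
  -- it is non-empty
  have hWne : (C ∩ f ⁻¹' Iio 0).Nonempty := by
    have hT1 : ContMDiff 𝓘(ℝ, E) 𝓘(ℝ, E).tangent 1
        (fun y ↦ (⟨y, τ.vectorField y⟩ : TangentBundle 𝓘(ℝ, E) M)) := τ.contMDiff.of_le hn1
    obtain ⟨Γ, D, hΓ, hDo, h0D, hΓ0, -⟩ :=
      g.exists_isEndlessTimelikeCurve_isMIntegralCurveAt τ hT1 τ.isTimelike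
        τ.isFutureDirected_vectorField x
    have hΓ0VL : Γ 0 ∈ VL := by rw [hΓ0]; exact hxVL
    obtain ⟨t₁, ht₁J, ht₁O, ht₁f⟩ :=
      IsCauchyHypersurface.exists_mem_connectedComponentIn hres hτ hVL hΓ h0D hΓ0VL
    obtain ⟨hDord, hΓt, -, -⟩ := hΓ
    set J : Set ℝ := connectedComponentIn (D ∩ Γ ⁻¹' (VL : Set M)) 0 with hJ_def
    have hJsub : J ⊆ D ∩ Γ ⁻¹' (VL : Set M) := connectedComponentIn_subset _ _
    have hJord : J.OrdConnected :=
      isPreconnected_iff_ordConnected.1 isPreconnected_connectedComponentIn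
    have h0J : (0 : ℝ) ∈ J := mem_connectedComponentIn ⟨h0D, hΓ0VL⟩
    have hmono : StrictMonoOn (f ∘ Γ) J :=
      strictMonoOn_comp_of_mfderiv_pos τ hfO hdf hJord
        (hΓt.isFutureCausalCurveOn.mono fun t ht ↦ (hJsub ht).1)
        fun t ht ↦ hNO (hVLN (hJsub ht).2)
    rcases lt_or_ge 0 t₁ with ht₁ | ht₁
    · -- `f x < f (Γ t₁) = 0`
      have hlt : f (Γ 0) < f (Γ t₁) := hmono h0J ht₁J ht₁
      rw [hΓ0, ht₁f] at hlt
      exact ⟨x, hxC, hlt⟩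
    · -- the segment `Γ([t₁, 0])` lies in `A`, so `Γ t₁ ∈ C`
      have hseg : ∀ t ∈ Icc t₁ 0, Γ t ∈ A := fun t ht ↦ by
        have htJ : t ∈ J := hJord.out ht₁J h0J ht
        have htVL : Γ t ∈ (VL : Set M) := (hJsub htJ).2
        refine ⟨hconv x hxG ⟨mem_causalPast_singleton_iff.2 ?_, hVLS htVL⟩, htVL⟩
        rcases ht.2.eq_or_lt with h | h
        · rw [h, hΓ0]; exact subset_causalFuture (g := g) (τ := τ) _ rfl
        · rw [← hΓ0]
          exact Or.inr ⟨Γ t, rfl, Γ, t, 0, h,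
            (hΓt.mono (hDord.out (hJsub htJ).1 h0D)).isFutureCausalCurveOn, rfl, rfl⟩
      have hKc : IsPreconnected (Γ '' Icc t₁ 0) :=
        isPreconnected_Icc.image Γ fun t ht ↦
          (hΓt t (hJsub (hJord.out ht₁J h0J ht)).1).1.continuousAt.continuousWithinAt
      have hKC : Γ '' Icc t₁ 0 ⊆ C :=
        hKc.subset_connectedComponentIn ⟨0, right_mem_Icc.2 ht₁, hΓ0⟩
          (by rintro _ ⟨t, ht, rfl⟩; exact hseg t ht)
      have hzC : Γ t₁ ∈ C := hKC ⟨t₁, left_mem_Icc.2 ht₁, rfl⟩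
      -- just before `t₁` the curve is in `C` and has `f < 0`
      have hcont : ContinuousAt Γ t₁ := (hΓt t₁ (hJsub ht₁J).1).1.continuousAt
      have hev : ∀ᶠ s in 𝓝 t₁, Γ s ∈ C ∧ s ∈ D := by
        filter_upwards [hcont.preimage_mem_nhds (hCo.mem_nhds hzC), hDo.mem_nhds (hJsub ht₁J).1]
          with s hs hs' using ⟨hs, hs'⟩
      obtain ⟨ε, hε, hball⟩ := Metric.mem_nhds_iff.1 hev
      have hIcc : ∀ u ∈ Icc (t₁ - ε / 2) t₁, Γ u ∈ C ∧ u ∈ D := fun u hu ↦ by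
        refine hball ?_
        rw [Metric.mem_ball, Real.dist_eq, abs_sub_comm, abs_of_nonneg (by linarith [hu.2])]
        linarith [hu.1]
      have hmono' : StrictMonoOn (f ∘ Γ) (Icc (t₁ - ε / 2) t₁) :=
        strictMonoOn_comp_of_mfderiv_pos τ hfO hdf ordConnected_Icc
          (hΓt.isFutureCausalCurveOn.mono fun u hu ↦ (hIcc u hu).2)
          fun u hu ↦ hCO (hIcc u hu).1
      have hst₁ : t₁ - ε / 2 < t₁ := by linarith
      have hlt : f (Γ (t₁ - ε / 2)) < f (Γ t₁) :=
        hmono' (left_mem_Icc.2 hst₁.le) (right_mem_Icc.2 hst₁.le) hst₁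
      rw [ht₁f] at hlt
      exact ⟨Γ (t₁ - ε / 2), (hIcc _ (left_mem_Icc.2 hst₁.le)).1, hlt⟩
  -- unique continuation on `C`
  have key := PseudoRiemannianMetric.IsKillingFieldOn.eqOn_of_isPreconnected_of_eqOn hCo
    isPreconnected_connectedComponentIn hWo inter_subset_left hWne
    (hζ.mono fun r hr ↦ (hCA hr).1) (hζ'.mono fun r hr ↦ hVLN (hCA hr).2)
    (fun y hy ↦ (hagree y (hVLN (hCA hy.1).2) hy.2).symm)
  exact key hxC

/-! ### The continuation step and the globalisation theorem -/

/-- **One continuation step (future side).** Let `S` be a Cauchy hypersurface of the connected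
`(M, g, τ)` (`C^∞` metric), assume the local continuation step `hstep` for `τ`, and let `G ⊇ S`
be open, causally convex relative to `S`, carrying a Killing field `ζ`, with `∂G ∩ I⁺(S) ≠ ∅`.
Then there is a strictly larger open `W ⊇ G`, again causally convex relative to `S`, carrying a
Killing field equal to `ζ` on `G`. Proof (Sbierski 2016, §3.2, proof of Thm. 12, with Killing
fields for isometries): Sbierski's spacelike frontier point `p₀` with its local temporal function
`f` (`exists_temporal_boundaryPoint_future'`), the local step on `{f < 0} ⊆ G`, a lens `V_L ∋ p₀`
inside `N ∩ I⁺(S)` with Cauchy hypersurface `{f = 0}`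
(`exists_isCauchyHypersurface_restrict_of_timeFunction`), `W = G ∪ V_L` (globally hyperbolic with
Cauchy hypersurface `S` by `restrict_sup_of_subset_closure`, hence causally convex), and the glued
field (`isKillingFieldOn_apply_eq_of_lens`, `IsKillingFieldOn.of_locally`). Moncrief 1975, §III.
[cite: Moncrief1975, §III] [cite: Sbierski2016AHP, §3.2, proof of Thm. 12 (arXiv numbering)] -/
theorem IsCauchyHypersurface.exists_isKillingFieldOn_extension_of_frontier [ConnectedSpace M]
    [LocallyConnectedSpace M] [T2Space M] [SecondCountableTopology M]
    [CovariantDerivative.ContMDiffCovariantDerivative g.leviCivita 1]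
    (hres : PseudoRiemannianMetric.contMDiff_restrict (I := 𝓘(ℝ, E)) (n := ∞) (M := M))
    (hτ : τ.contMDiff_restrict) {S : Set M} (hS : g.IsCauchyHypersurface τ S)
    (hstep : ∀ (p₀ : M) (O : Set M) (f : M → ℝ), IsOpen O → p₀ ∈ O →
      ContMDiffOn 𝓘(ℝ, E) 𝓘(ℝ, ℝ) ∞ f O → f p₀ = 0 →
      (∀ r ∈ O, ∀ v : TangentSpace 𝓘(ℝ, E) r, τ.IsFutureDirected v →
        (0 : ℝ) < mfderiv 𝓘(ℝ, E) 𝓘(ℝ, ℝ) f r v) →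
      ∀ ζ : Π x : M, TangentSpace 𝓘(ℝ, E) x, g.IsKillingFieldOn ζ {r | r ∈ O ∧ f r < 0} →
      ∃ N : Set M, IsOpen N ∧ p₀ ∈ N ∧ N ⊆ O ∧
        ∃ ζ' : Π x : M, TangentSpace 𝓘(ℝ, E) x, g.IsKillingFieldOn ζ' N ∧
          ∀ r ∈ N, f r < 0 → ζ' r = ζ r)
    {G : Opens M} (hSG : S ⊆ G)
    (hconv : ∀ x ∈ G, g.causalPast τ {x} ∩ g.causalFuture τ S ⊆ G)
    (hconv' : ∀ x ∈ G, g.causalFuture τ {x} ∩ g.causalPast τ S ⊆ G)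
    {ζ : Π x : M, TangentSpace 𝓘(ℝ, E) x} (hζ : g.IsKillingFieldOn ζ G)
    (hne : (frontier (G : Set M) ∩ g.chronologicalFuture τ S).Nonempty) :
    ∃ W : Opens M, (G : Set M) ⊆ W ∧ (∃ p ∈ W, p ∉ G) ∧
      (∀ x ∈ W, g.causalPast τ {x} ∩ g.causalFuture τ S ⊆ W) ∧
      (∀ x ∈ W, g.causalFuture τ {x} ∩ g.causalPast τ S ⊆ W) ∧
      ∃ ζW : Π x : M, TangentSpace 𝓘(ℝ, E) x, g.IsKillingFieldOn ζW W ∧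
        ∀ y ∈ G, ζW y = ζ y := by
  classical
  have hn : (∞ : ℕ∞ω) ≤ ∞ := le_rfl
  have hn2 : (2 : ℕ∞ω) ≤ ∞ := WithTop.coe_le_coe.mpr le_top
  have hn1 : (1 : ℕ∞ω) ≤ ∞ := WithTop.coe_le_coe.mpr le_top
  -- `S` is a Cauchy hypersurface of `G`
  have hGc : (g.restrict hres G).IsCauchyHypersurface (τ.restrict hres hτ G)
      (Subtype.val ⁻¹' S) :=
    hS.restrict_of_causallyConvex τ hn hres hτ hSG hconv hconv'
  -- Sbierski's frontier point and its local temporal function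
  obtain ⟨p₀, O, f, hp₀fr, hp₀I, hOo, hp₀O, hfO, hf0, hdf, hzero, hneg⟩ :=
    hS.exists_temporal_boundaryPoint_future' τ hn hres hτ hSG hGc hne
  have hfO' : ∀ x ∈ O, MDifferentiableAt 𝓘(ℝ, E) 𝓘(ℝ, ℝ) f x := fun x hx ↦
    (hfO.contMDiffAt (hOo.mem_nhds hx)).mdifferentiableAt (by simp)
  -- the local continuation step across `p₀`
  obtain ⟨N, hNo, hp₀N, hNO, ζ', hζ', hagree⟩ :=
    hstep p₀ O f hOo hp₀O hfO hf0 hdf ζ (hζ.mono fun r hr ↦ hneg r hr.1 hr.2)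
  -- a lens around `p₀` inside `N ∩ I⁺(S)` in which `{f = 0}` is a Cauchy hypersurface
  have hIo : IsOpen (g.chronologicalFuture τ S) := isOpen_chronologicalFuture_of_boundaryless g τ S
  have hW₁ : N ∩ g.chronologicalFuture τ S ∈ 𝓝 p₀ := (hNo.inter hIo).mem_nhds ⟨hp₀N, hp₀I⟩
  have hfAt : ContMDiffAt 𝓘(ℝ, E) 𝓘(ℝ, ℝ) 1 f p₀ :=
    (hfO.contMDiffAt (hOo.mem_nhds hp₀O)).of_le hn1
  set S' : Set M := {q | q ∈ O ∧ f q = 0} with hS'_def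
  have hS'ev : ∀ᶠ q in 𝓝 p₀, q ∈ S' ↔ f q = 0 := by
    filter_upwards [hOo.mem_nhds hp₀O] with q hq
    exact ⟨fun h ↦ h.2, fun h ↦ ⟨hq, h⟩⟩
  obtain ⟨VL, hp₀VL, hVLW, hVL⟩ :=
    exists_isCauchyHypersurface_restrict_of_timeFunction (g := g) (τ := τ) hn1 hres hτ hfAt hf0
      (hdf p₀ hp₀O) hS'ev hW₁
  have hVLN : (VL : Set M) ⊆ N := fun q hq ↦ (hVLW hq).1
  have hVLI : (VL : Set M) ⊆ g.chronologicalFuture τ S := fun q hq ↦ (hVLW hq).2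
  -- `S` is a Cauchy hypersurface of `G ∪ V_L`, which is therefore causally convex
  have hS'cl : S' ⊆ closure (G : Set M) := fun q hq ↦ hzero q hq.1 hq.2
  have hWc : (g.restrict hres (G ⊔ VL)).IsCauchyHypersurface (τ.restrict hres hτ (G ⊔ VL))
      (Subtype.val ⁻¹' S) :=
    hS.restrict_sup_of_subset_closure hres hτ hn2 hGc hVL hS'cl
  have hWconv : ∀ x ∈ (G ⊔ VL : Opens M),
      g.causalPast τ {x} ∩ g.causalFuture τ S ⊆ ((G ⊔ VL : Opens M) : Set M) :=
    fun x hx ↦ hS.causalPast_inter_causalFuture_subset_of_restrict τ hn2 hres hτ hWc hx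
  have hWconv' : ∀ x ∈ (G ⊔ VL : Opens M),
      g.causalFuture τ {x} ∩ g.causalPast τ S ⊆ ((G ⊔ VL : Opens M) : Set M) :=
    fun x hx ↦ hS.causalFuture_inter_causalPast_subset_of_restrict τ hn2 hres hτ hWc hx
  -- the two Killing fields agree on `G ∩ V_L`
  have hag : ∀ x ∈ (G : Set M) ∩ VL, ζ x = ζ' x := fun x hx ↦
    isKillingFieldOn_apply_eq_of_lens τ hres hτ G.isOpen hconv hζ hfO' hdf hNO hζ' hagree hVLN
      (hVLI.trans (chronologicalFuture_subset_causalFuture g τ S)) hVL hx.1 hx.2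
  -- the glued field
  let ζW : Π x : M, TangentSpace 𝓘(ℝ, E) x := fun x ↦ if x ∈ (G : Set M) then ζ x else ζ' x
  have hζW_G : ∀ y ∈ (G : Set M), ζW y = ζ y := fun y hy ↦ if_pos hy
  have hζW_VL : ∀ y ∈ (VL : Set M), ζW y = ζ' y := fun y hy ↦ by
    by_cases hyG : y ∈ (G : Set M)
    · rw [hζW_G y hyG]; exact hag y ⟨hyG, hy⟩
    · exact if_neg hyG
  have hζW : g.IsKillingFieldOn ζW ((G ⊔ VL : Opens M) : Set M) := by
    refine PseudoRiemannianMetric.IsKillingFieldOn.of_locally fun z hz ↦ ?_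
    rw [Opens.coe_sup] at hz
    rcases hz with hz | hz
    · exact ⟨G, ζ, G.isOpen, hz, hζ, hζW_G⟩
    · exact ⟨VL, ζ', VL.isOpen, hz, hζ'.mono hVLN, hζW_VL⟩
  refine ⟨G ⊔ VL, fun y hy ↦ Opens.mem_sup.2 (Or.inl hy),
    ⟨p₀, Opens.mem_sup.2 (Or.inr hp₀VL), fun h ↦ ?_⟩, hWconv, hWconv', ζW, hζW, hζW_G⟩
  -- `p₀ ∈ ∂G` is not in the open set `G`
  have hp₀ : p₀ ∉ interior (G : Set M) := hp₀fr.2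
  rw [G.isOpen.interior_eq] at hp₀
  exact hp₀ h

/-- **Globalisation of Killing fields given near a Cauchy hypersurface, modulo the local
continuation step** (Moncrief 1975, §III; Fischer–Marsden–Moncrief 1980, Lemma 2.2 — the
topological half). Let `S` be a Cauchy hypersurface of the connected time-oriented `C^∞`
Lorentzian manifold `(M, g, τ)` and assume the LOCAL CONTINUATION STEP for every time orientation
`τ'` of `g`: for every point `p₀`, every `f`, `C^∞` on an open `O ∋ p₀` with `f p₀ = 0` and
`df_r(v) > 0` for all `r ∈ O` and all `τ'`-future-directed `v`, every Killing field on
`{f < 0} ∩ O` agrees on `{f < 0} ∩ N` with a Killing field of some open `N`, `p₀ ∈ N ⊆ O`. Then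
every Killing field `ξ` of `g` on an open `U₀ ⊇ S` agrees, on an open `V₀` with `S ⊆ V₀ ⊆ U₀`,
with a Killing field `ξ'` of `g` on all of `M`. Proof: the union `Good` of all admissible regions
(open, `⊇ V₀`, causally convex relative to `S`, carrying a Killing field equal to `ξ` on `V₀`;
coherent by `isKillingFieldOn_apply_eq_of_causallyConvex`) is admissible; were `Good ≠ M`, its
frontier would meet `I⁺(S)` or `I⁻(S)` (`frontier_inter_chronological_nonempty_of_ne_univ`) and
`exists_isKillingFieldOn_extension_of_frontier` (for `τ`, resp. `-τ`) would produce a strictly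
larger admissible region. [cite: Moncrief1975, §III]
[cite: FischerMarsdenMoncrief1980, Lemma 2.2 (pp. 161–162)] -/
theorem IsCauchyHypersurface.exists_isKillingFieldOn_univ_of_localStep [ConnectedSpace M]
    [LocallyConnectedSpace M] [T2Space M] [SecondCountableTopology M]
    [CovariantDerivative.ContMDiffCovariantDerivative g.leviCivita 1]
    (hres : PseudoRiemannianMetric.contMDiff_restrict (I := 𝓘(ℝ, E)) (n := ∞) (M := M))
    (hτ : τ.contMDiff_restrict) {S : Set M} (hS : g.IsCauchyHypersurface τ S)
    (hstep : ∀ (τ' : TimeOrientation g) (p₀ : M) (O : Set M) (f : M → ℝ), IsOpen O → p₀ ∈ O →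
      ContMDiffOn 𝓘(ℝ, E) 𝓘(ℝ, ℝ) ∞ f O → f p₀ = 0 →
      (∀ r ∈ O, ∀ v : TangentSpace 𝓘(ℝ, E) r, τ'.IsFutureDirected v →
        (0 : ℝ) < mfderiv 𝓘(ℝ, E) 𝓘(ℝ, ℝ) f r v) →
      ∀ ζ : Π x : M, TangentSpace 𝓘(ℝ, E) x, g.IsKillingFieldOn ζ {r | r ∈ O ∧ f r < 0} →
      ∃ N : Set M, IsOpen N ∧ p₀ ∈ N ∧ N ⊆ O ∧
        ∃ ζ' : Π x : M, TangentSpace 𝓘(ℝ, E) x, g.IsKillingFieldOn ζ' N ∧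
          ∀ r ∈ N, f r < 0 → ζ' r = ζ r)
    {U₀ : Set M} (hU₀ : IsOpen U₀) (hSU₀ : S ⊆ U₀)
    {ξ : Π x : M, TangentSpace 𝓘(ℝ, E) x} (hξ : g.IsKillingFieldOn ξ U₀) :
    ∃ ξ' : Π x : M, TangentSpace 𝓘(ℝ, E) x, g.IsKillingFieldOn ξ' univ ∧
      ∃ V₀ : Set M, IsOpen V₀ ∧ S ⊆ V₀ ∧ V₀ ⊆ U₀ ∧ ∀ y ∈ V₀, ξ' y = ξ y := by
  classical
  have hn : (∞ : ℕ∞ω) ≤ ∞ := le_rfl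
  have hn2 : (2 : ℕ∞ω) ≤ ∞ := WithTop.coe_le_coe.mpr le_top
  -- Step 0: a causally convex neighbourhood `V₀` of `S` inside `U₀`
  obtain ⟨V₀, hSV₀, hV₀U, hV₀c, hV₀c', -⟩ :=
    hS.exists_causallyConvex_opens_subset τ hn hres hτ (U := ⟨U₀, hU₀⟩) hSU₀
  -- admissible regions
  let adm : Opens M → Prop := fun V ↦ (V₀ : Set M) ⊆ V ∧
    (∀ x ∈ V, g.causalPast τ {x} ∩ g.causalFuture τ S ⊆ V) ∧
    (∀ x ∈ V, g.causalFuture τ {x} ∩ g.causalPast τ S ⊆ V) ∧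
    ∃ ζ : Π x : M, TangentSpace 𝓘(ℝ, E) x, g.IsKillingFieldOn ζ V ∧
      ∀ y ∈ (V₀ : Set M), ζ y = ξ y
  have hadm₀ : adm V₀ := ⟨Subset.rfl, hV₀c, hV₀c', ξ, hξ.mono hV₀U, fun _ _ ↦ rfl⟩
  -- coherence: admissible Killing fields agree on common points
  have hcoh : ∀ {V V' : Opens M} {ζ ζ' : Π x : M, TangentSpace 𝓘(ℝ, E) x},
      adm V → adm V' → g.IsKillingFieldOn ζ V → (∀ y ∈ (V₀ : Set M), ζ y = ξ y) →
      g.IsKillingFieldOn ζ' V' → (∀ y ∈ (V₀ : Set M), ζ' y = ξ y) →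
      ∀ x ∈ (V : Set M) ∩ V', ζ x = ζ' x := by
    intro V V' ζ ζ' hV hV' hζ hζξ hζ' hζ'ξ x hx
    have hA : IsOpen ((V : Set M) ∩ V') := V.isOpen.inter V'.isOpen
    have hcv : ∀ y ∈ (V : Set M) ∩ V',
        g.causalPast τ {y} ∩ g.causalFuture τ S ⊆ (V : Set M) ∩ V' :=
      fun y hy ↦ subset_inter (hV.2.1 y hy.1) (hV'.2.1 y hy.2)
    have hcv' : ∀ y ∈ (V : Set M) ∩ V',
        g.causalFuture τ {y} ∩ g.causalPast τ S ⊆ (V : Set M) ∩ V' :=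
      fun y hy ↦ subset_inter (hV.2.2.1 y hy.1) (hV'.2.2.1 y hy.2)
    exact isKillingFieldOn_apply_eq_of_causallyConvex τ hn2 hS V₀.isOpen hSV₀
      hA hcv hcv' (hζ.mono inter_subset_left)
      (hζ'.mono inter_subset_right) (fun y hy ↦ (hζξ y hy).trans (hζ'ξ y hy).symm) hx
  -- chosen Killing fields of the admissible regions, glued over their union `Good`
  have hch : ∀ V : {V : Opens M // adm V}, ∃ ζ : Π x : M, TangentSpace 𝓘(ℝ, E) x,
      g.IsKillingFieldOn ζ V.1 ∧ ∀ y ∈ (V₀ : Set M), ζ y = ξ y := fun V ↦ V.2.2.2.2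
  choose ζof hζof hζofξ using hch
  let Good : Opens M := sSup {V | adm V}
  have hmemGood : ∀ {x : M}, x ∈ Good ↔ ∃ V, adm V ∧ x ∈ V := fun {x} ↦ by
    show x ∈ sSup {V | adm V} ↔ _
    rw [Opens.mem_sSup]
    simp only [mem_setOf_eq]
  let ζG : Π x : M, TangentSpace 𝓘(ℝ, E) x := fun x ↦
    if h : ∃ V : Opens M, adm V ∧ x ∈ V then ζof ⟨h.choose, h.choose_spec.1⟩ x else 0
  have hζG_eq : ∀ (V : Opens M) (hV : adm V), ∀ x ∈ V, ζG x = ζof ⟨V, hV⟩ x := by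
    intro V hV x hx
    have h : ∃ V : Opens M, adm V ∧ x ∈ V := ⟨V, hV, hx⟩
    have h1 : ζG x = ζof ⟨h.choose, h.choose_spec.1⟩ x := by simp only [ζG, dif_pos h]
    rw [h1]
    exact hcoh h.choose_spec.1 hV (hζof _) (hζofξ _) (hζof _) (hζofξ _) x ⟨h.choose_spec.2, hx⟩
  have hGood_adm : adm Good := by
    refine ⟨fun y hy ↦ hmemGood.2 ⟨V₀, hadm₀, hy⟩, fun x hx ↦ ?_, fun x hx ↦ ?_, ζG, ?_,
      fun y hy ↦ ?_⟩
    · obtain ⟨V, hV, hxV⟩ := hmemGood.1 hx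
      exact (hV.2.1 x hxV).trans fun y hy ↦ hmemGood.2 ⟨V, hV, hy⟩
    · obtain ⟨V, hV, hxV⟩ := hmemGood.1 hx
      exact (hV.2.2.1 x hxV).trans fun y hy ↦ hmemGood.2 ⟨V, hV, hy⟩
    · refine PseudoRiemannianMetric.IsKillingFieldOn.of_locally fun z hz ↦ ?_
      obtain ⟨V, hV, hzV⟩ := hmemGood.1 hz
      exact ⟨V, ζof ⟨V, hV⟩, V.isOpen, hzV, hζof _, hζG_eq V hV⟩
    · rw [hζG_eq V₀ hadm₀ y hy]
      exact hζofξ _ y hy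
  have hSGood : S ⊆ Good := fun y hy ↦ hGood_adm.1 (hSV₀ hy)
  have hmax : ∀ W : Opens M, adm W → (W : Set M) ⊆ Good := fun W hW y hy ↦
    hmemGood.2 ⟨W, hW, hy⟩
  -- `Good = M` finishes the proof
  suffices huniv : (Good : Set M) = univ by
    obtain ⟨-, -, -, ζ, hζ, hζξ⟩ := hGood_adm
    rw [huniv] at hζ
    exact ⟨ζ, hζ, V₀, V₀.isOpen, hSV₀, hV₀U, hζξ⟩
  by_contra hne
  obtain ⟨hG₀, hGc, hGc', ζ, hζ, hζξ⟩ := hGood_adm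
  rcases hS.frontier_inter_chronological_nonempty_of_ne_univ τ hn2 hSGood hne with h | h
  · -- a future frontier point: extend with `τ`
    obtain ⟨W, hGW, ⟨p, hpW, hpG⟩, hWc, hWc', ζW, hζW, hζWG⟩ :=
      hS.exists_isKillingFieldOn_extension_of_frontier τ hres hτ (hstep τ) hSGood hGc hGc' hζ h
    exact hpG (hmax W ⟨hG₀.trans hGW, hWc, hWc', ζW, hζW,
      fun y hy ↦ (hζWG y (hG₀ hy)).trans (hζξ y hy)⟩ hpW)
  · -- a past frontier point: the same for `-τ`
    have hGcr : ∀ x ∈ Good, g.causalPast τ.reverse {x} ∩ g.causalFuture τ.reverse S ⊆ Good :=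
      fun x hx ↦ by rw [causalPast_reverse]; exact hGc' x hx
    have hGcr' : ∀ x ∈ Good, g.causalFuture τ.reverse {x} ∩ g.causalPast τ.reverse S ⊆ Good :=
      fun x hx ↦ by rw [causalPast_reverse]; exact hGc x hx
    obtain ⟨W, hGW, ⟨p, hpW, hpG⟩, hWc, hWc', ζW, hζW, hζWG⟩ :=
      hS.reverse.exists_isKillingFieldOn_extension_of_frontier τ.reverse hres
        (τ.contMDiff_restrict_reverse hτ) (hstep τ.reverse) hSGood hGcr hGcr' hζ h
    refine hpG (hmax W ⟨hG₀.trans hGW, fun x hx ↦ ?_, fun x hx ↦ ?_, ζW, hζW,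
      fun y hy ↦ (hζWG y (hG₀ hy)).trans (hζξ y hy)⟩ hpW)
    · have h1 := hWc' x hx
      rwa [causalPast_reverse] at h1
    · have h1 := hWc x hx
      rwa [causalPast_reverse] at h1

end Killing

end LorentzianMetric

end Literature.Geometry.Lorentzian

end
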